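import Literature.Barriers.CriticalPhenomena.LaceExpansionXSpaceChainSplits
import Literature.Barriers.CriticalPhenomena.LaceExpansionXSpaceTriangleNumerics
import HarnessLib

/-!
# Hara's weighted `N`-loop bound on the Hara–Slade diagrams at `p_c` and Lemma 1.6 (percolation) in the
# `T̄^{(0,β)}`-variant — PROVED from the Hara–Slade coefficients and the smallness `2Δ̃_{p_c}Δ_{p_c} < 1`

Barrier catalogue `Literature/Barriers/CriticalPhenomena/` (D-0021). Tenth layer of the decomposition of
`Hara2008_lemma16Pc` (`LaceExpansionXSpaceNorms.lean`; Hara 2008, Lemma 1.6: "For percolation with `λ` sufficiently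
small, suppose `W̄^{(β,γ)}`, `T̄^{(0,γ)}` and `H̄^{(β)}` are finite for some `β, γ ≥ 0`. Then `Σ_x |x|^{β+γ}|Π(x)| < ∞`").
PROVED here:

* `tsum_wE_wE_piNDiagramPc_succ_le_of_chains` (any per-chain constants) and `tsum_wE_wE_piNDiagramPc_succ_le_const`
  (Hara's constants `Cbig`) — Steps 1–3 of §3.4 on the diagrams (7.4.10):
  `Σ_x |x|^b|x|^c [diagram of Π^{(n+1)}](x) ≤ K_b(M) K_c(M) [|0|^b|0|^c C(0,0) + |0|^b M C(0,c) + |0|^c M C(b,0) + M² C(b,c)]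
  K^{n-4}` (`M = 2n+3 = 2N+1`, `K = 2Δ̃_{p_c}Δ_{p_c} ≤ 1`; "The number of choices of 'long' segments are bounded by
  `(2N+1)²`");
* `Cbig_lt_top` — the constants are finite under `W̄^{(β,γ)}, T̄^{(0,γ)}, T̄^{(0,β)} < ∞` (`β, γ ≥ 0`): via
  `W̄^{(c,0)} ≤ T̄^{(0,c)}`, `W̄^{(0,0)} ≤ W̄^{(β,0)} + 1`, `Δ_{p_c} = T̄^{(0,0)} ≤ T̄^{(0,γ)} + W̄^{(0,0)}`, `Δ̃_{p_c} ≤ 2dΔ_{p_c}`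
  and the symmetries `W̄^{(b,c)} = W̄^{(c,b)}`, `T̄^{(b,c)} = T̄^{(c,b)}`;
* `weightedNLoopBound_of_chains` (any finite per-chain constants) and `weightedNLoopBound_of_small` — HARA'S FORM: for `β, γ ≥ 0` with `W̄^{(β,γ)}, T̄^{(0,γ)}, T̄^{(0,β)} < ∞` and `K < 1`
  there are `c` and `ρ ∈ (0,1)` with `Σ_x |x|^{β+γ} [diagram of Π^{(N)}](x) ≤ c (N+1)^{2+β+γ} ρ^N`, `N ≥ 1` ("the
  `N`-loop contribution is thus bounded by `c N^{2+β+γ}(2c'λ)^{N-2}`");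
* `Hara2008_lemma16T_of_diagramBounds` — **Lemma 1.6, `T̄^{(0,β)}`-variant**: from `HvdH2017_piNDiagramBoundPc` (the
  Hara–Slade coefficients at `p_c` below the diagrams; `LaceExpansionXSpaceLemma16.lean`) and `∀ d ≥ 11, K < 1`:
  for `d ≥ 11`, the lace-expansion coefficient `Φ`, `β, γ ≥ 0` with `W̄^{(β,γ)}, T̄^{(0,γ)}, T̄^{(0,β)} < ∞`:
  `Σ_x |x|^{β+γ} |Φ(x)| < ∞`.
* `weightedNLoopBoundT_of_triangleBounds` — Hara's form for every `d ≥ 11` from `FitznerVanDerHofstad2017_triangleBoundsPc`;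
* `Hara2008_lemma16T_of_triangleBounds` — the same from `HvdH2017_piNDiagramBoundPc` and the catalogue's numerical
  input `FitznerVanDerHofstad2017_triangleBoundsPc` (`LaceExpansionXSpaceTriangleNumerics.lean`: `T_{p_c} ≤ 0.28036`,
  `T̄^{(0,0)} ≤ 0.53562`, whence `K = 2Δ̃_{p_c}Δ_{p_c} < 1` for `d ≥ 11`), i.e. the variant of Lemma 1.6 modulo exactly
  the two named facts on which the catalogue rests the printed `Hara2008_lemma16Pc`.

WHY `T̄^{(0,β)}` (scope of the printed proof). Hara's Step 3 lists the weighted middle factors as `W̄^{(β,γ)}`,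
`W̄^{(β,0)}T̄^{(0,γ)}` or `H̄^{(β)}T̄^{(0,γ)}`, case (b-7) being "This is nothing but `H^{(β)}(a,b)` … [Other parts can be
decomposed into triangles and `T^{(0,γ)}`]". On the diagrams (7.4.10) the configuration in which the `γ`-mark sits on
the pivotal line entering a unit whose `B₂` is the second term `B₂⁽²⁾` (the only line of the lower path in that unit)
while the `β`-mark sits on that unit's upper path line produces the two-loop factor `H^{(β)}` WITH ITS OUTER LINE
`γ`-WEIGHTED, which none of the three printed alternatives bounds; every decomposition of it we found needs
`T̄^{(0,β)}`, a square `S̄`, or a doubly weighted `H`. With `T̄^{(0,β)} < ∞` as an additional hypothesis that factor —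
and then every `β`-on-`B₂⁽²⁾` factor — is bounded through `‖B̃₂⁽²⁾^{(β,c)} P‖_{1→1} ≤ |0|^c T̄^{(0,β)} ‖ρP‖_{1→1}`
(`LaceExpansionXSpaceWeightedPieces.lean`), and `H̄^{(β)}` is not needed. In the application of Lemma 1.6 in the tree
(`LaceExpansionXSpaceBootstrap.piMoment_step`: `β = 2`, `γ = n - 1/4`, `d ≥ 11`) the extra hypothesis
`T̄^{(0,2)} < ∞` is supplied by Lemma 1.7 exactly as `T̄^{(0,γ)} < ∞` is. The named fact `Hara2008_lemma16Pc` (the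
printed hypotheses) is therefore NOT discharged by this file; what is proved is the variant, conditional on the
Hara–Slade coefficients (`HvdH2017_piNDiagramBoundPc`) and on the smallness of the triangles at `p_c` in `d ≥ 11`
(`2Δ̃_{p_c}Δ_{p_c} < 1`; in print: Heydenreich–van der Hofstad's "we need that `2Δ̃_pΔ_p < 1`", and numerically at
`d = 11` Fitzner–van der Hofstad's `T_{p_c} ≤ 0.28036`, `T̄^{(0,0)} ≤ 0.53562`, whence `2Δ̃Δ ≤ 2·0.28036·1.53562 < 1`).

## References

* T. Hara, Ann. Probab. 36 (2008) 530–593 (arXiv:math-ph/0504021): Lemma 1.6; §1.2 (scope); §3.4 (Steps 1–3 and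
  Summary, cases (b-2), (b-3), (b-7)); §1.2.4 (the recursion with `β_{i+1} = 2`).
* M. Heydenreich, R. van der Hofstad, *Progress in High-Dimensional Percolation and Random Graphs*, Springer 2017:
  (7.4.10), Prop. 7.4 and the remark after it ("we need that `2Δ̃_pΔ_p < 1`"), §7.5.2.
* R. Fitzner, R. van der Hofstad, Electron. J. Probab. 22 (2017) no. 43: §7 (proofs of Thms. 1.4–1.5:
  `T̄^{(0,0)} ≤ 0.53562`, `T_{p_c} = 2dp_c sup_x(τ^{⋆3}⋆D)(x) ≤ 0.28036` in `d = 11`; `Π̂^{(N)}_{p_c}(0) ≤ T'[2TT']^{N-1}`).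
-/

noncomputable section

namespace Literature.Barriers.CriticalPhenomena

open _root_.MeasureTheory _root_.Filter Literature.Probability.LatticeModels
  Literature.Probability.Percolation

open scoped ENNReal

/-! ### Assembly: the doubly weighted diagram of `Π^{(N)}` is `≤ poly(N) · C · K^{N-5}` -/

section Assembly

variable {d : ℕ}

/-- No marks: zero exponents. [folklore] -/
theorem exv_zero_zero : exv 0 0 0 0 = eZero := by
  funext k; unfold exv eZero; split_ifs <;> rfl

/-- A zero mark is no mark. [folklore] -/
theorem setB_eZero_zero (j : ℕ) : setB eZero j 0 = eZero := by
  funext k; unfold setB eZero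
  by_cases hk : k = j
  · subst hk; rw [Function.update_self]; split <;> rfl
  · rw [Function.update_of_ne hk]

/-- A zero `P₂`-mark is no mark. [folklore] -/
theorem setC_zero_of_p2zero {ex : ℕ → ℝ × ℝ} (h : P2zero ex) (l : ℕ) : setC ex l 0 = ex := by
  funext k; unfold setC
  by_cases hk : k = l
  · subst hk; rw [Function.update_self]
    have := h k
    by_cases hp : pol k
    · rw [if_pos hp] at this ⊢; rw [← this]
    · rw [if_neg hp] at this ⊢; rw [← this]
  · rw [Function.update_of_ne hk]

/-- The single-`b` chains are `exv j j b 0`-chains. [folklore] -/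
theorem setB_eZero_eq_exv (j : ℕ) (b : ℝ) : setB eZero j b = exv j j b 0 := by
  rw [← setC_setB_eZero, setC_zero_of_p2zero (p2zero_setB p2zero_eZero j b)]

/-- The single-`c` chains are `exv l l 0 c`-chains. [folklore] -/
theorem setC_eZero_eq_exv (l : ℕ) (c : ℝ) : setC eZero l c = exv l l 0 c := by
  rw [← setC_setB_eZero, setB_eZero_zero]

/-- **Assembly of Steps 1–3 for any per-chain constant**: if every doubly marked chain of the diagram of
`Π^{(n+1)}` with marks `b' ∈ {0,b}`, `c' ∈ {0,c}` is `≤ C(b',c') K^{n-4}`, then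
`Σ_x |x|^b |x|^c [diagram](x) ≤ K_b(M) K_c(M) [ |0|^b|0|^c C(0,0) + |0|^b M C(0,c) + |0|^c M C(b,0) + M² C(b,c) ] K^{n-4}`
(`M = 2n+3 = 2N+1`; "The number of choices of 'long' segments are bounded by `(2N+1)²`").
[cite: Hara2008, §3.4 (Steps 1 and 3)] -/
theorem tsum_wE_wE_piNDiagramPc_succ_le_of_chains {b c : ℝ} (hb : 0 ≤ b) (hc : 0 ≤ c) (n : ℕ)
    (C : ℝ → ℝ → ℝ≥0∞)
    (hchain : ∀ (b' c' : ℝ) (j l : ℕ), (b' = 0 ∨ b' = b) → (c' = 0 ∨ c' = c) → j < 2 * n + 3 → l < 2 * n + 3 →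
      ∑' p, pkChainL (vDelta d) (mKsE d n (exv j l b' c')) p * eDiag d p ≤ C b' c' * KB d ^ (n - 4)) :
    ∑' x : Site d, wE b x * wE c x * piNDiagramPc d (n + 1) x ≤
      jK b (2 * n + 3) * jK c (2 * n + 3) *
        (wE b (0 : Site d) * wE c (0 : Site d) * C 0 0 + wE b (0 : Site d) * ((2 * n + 3 : ℕ) * C 0 c) +
          wE c (0 : Site d) * ((2 * n + 3 : ℕ) * C b 0) + (2 * n + 3 : ℕ) * ((2 * n + 3 : ℕ) * C b c)) *
        KB d ^ (n - 4) := by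
  set M := 2 * n + 3 with hM
  -- the four groups
  have h0 : ∑' p, pkChainL (vDelta d) (kernelsOf ((masterT d n).map toΦ)) p * eDiag d p ≤ C 0 0 * KB d ^ (n - 4) := by
    rw [masterT_eq_masterTE, kernelsOf_masterTE_toΦ, ← exv_zero_zero]
    exact hchain 0 0 0 0 (Or.inl rfl) (Or.inl rfl) (by omega) (by omega)
  have h1 : ∑ l ∈ Finset.range M, ∑' p, pkChainL (vDelta d) (kernelsOf (markAt c rd2 l ((masterT d n).map toΨ))) p *
      eDiag d p ≤ (M : ℝ≥0∞) * C 0 c * KB d ^ (n - 4) := by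
    refine (Finset.sum_le_sum (g := fun _ => C 0 c * KB d ^ (n - 4)) fun l hl => ?_).trans (le_of_eq ?_)
    · rw [Finset.mem_range] at hl
      rw [masterT_eq_masterTE, markAt_masterTE_toΨ p2zero_eZero c n hl, kernelsOf_masterTE_toΨ, setC_eZero_eq_exv]
      exact hchain 0 c l l (Or.inl rfl) (Or.inr rfl) hl hl
    · rw [Finset.sum_const, Finset.card_range, nsmul_eq_mul, mul_assoc]
  have h2 : ∑ j ∈ Finset.range M, ∑' p, pkChainL (vDelta d) (kernelsOf ((markAt₁ b rd1 j (masterT d n)).map toΨ)) p *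
      eDiag d p ≤ (M : ℝ≥0∞) * C b 0 * KB d ^ (n - 4) := by
    refine (Finset.sum_le_sum (g := fun _ => C b 0 * KB d ^ (n - 4)) fun j hj => ?_).trans (le_of_eq ?_)
    · rw [Finset.mem_range] at hj
      rw [masterT_eq_masterTE, markAt₁_masterTE p1zero_eZero b n hj, kernelsOf_masterTE_toΨ, setB_eZero_eq_exv]
      exact hchain b 0 j j (Or.inr rfl) (Or.inl rfl) hj hj
    · rw [Finset.sum_const, Finset.card_range, nsmul_eq_mul, mul_assoc]
  have h3 : ∑ j ∈ Finset.range M, ∑ l ∈ Finset.range M, dmChain d b c rd1 rd2 (masterT d n) j l (eDiag d) ≤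
      (M : ℝ≥0∞) * ((M : ℝ≥0∞) * C b c) * KB d ^ (n - 4) := by
    refine (Finset.sum_le_sum (g := fun _ => (M : ℝ≥0∞) * C b c * KB d ^ (n - 4)) fun j hj => ?_).trans
      (le_of_eq ?_)
    · rw [Finset.mem_range] at hj
      refine (Finset.sum_le_sum (g := fun _ => C b c * KB d ^ (n - 4)) fun l hl => ?_).trans (le_of_eq ?_)
      · rw [Finset.mem_range] at hl
        rw [dmChain_masterT_eq b c n hj hl, setC_setB_eZero]
        exact hchain b c j l (Or.inr rfl) (Or.inr rfl) hj hl
      · rw [Finset.sum_const, Finset.card_range, nsmul_eq_mul, mul_assoc]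
    · rw [Finset.sum_const, Finset.card_range, nsmul_eq_mul]; ring
  refine (tsum_wE_wE_piNDiagramPc_succ_le hb hc n).trans ?_
  rw [mul_assoc (jK b M * jK c M)]
  refine mul_le_mul' le_rfl ?_
  calc wE b (0 : Site d) * wE c (0 : Site d) * ∑' p, pkChainL (vDelta d) (kernelsOf ((masterT d n).map toΦ)) p * eDiag d p +
        wE b (0 : Site d) * ∑ l ∈ Finset.range M,
          ∑' p, pkChainL (vDelta d) (kernelsOf (markAt c rd2 l ((masterT d n).map toΨ))) p * eDiag d p +
        wE c (0 : Site d) * ∑ j ∈ Finset.range M,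
          ∑' p, pkChainL (vDelta d) (kernelsOf ((markAt₁ b rd1 j (masterT d n)).map toΨ)) p * eDiag d p +
        ∑ j ∈ Finset.range M, ∑ l ∈ Finset.range M, dmChain d b c rd1 rd2 (masterT d n) j l (eDiag d)
      ≤ wE b (0 : Site d) * wE c (0 : Site d) * (C 0 0 * KB d ^ (n - 4)) +
        wE b (0 : Site d) * ((M : ℝ≥0∞) * C 0 c * KB d ^ (n - 4)) +
        wE c (0 : Site d) * ((M : ℝ≥0∞) * C b 0 * KB d ^ (n - 4)) +
        (M : ℝ≥0∞) * ((M : ℝ≥0∞) * C b c) * KB d ^ (n - 4) :=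
        add_le_add (add_le_add (add_le_add (mul_le_mul' le_rfl h0) (mul_le_mul' le_rfl h1)) (mul_le_mul' le_rfl h2)) h3
    _ = _ := by ring


/-- **The four groups of marked chains of the diagram of `Π^{(n+1)}` are all `≤ C K^{n-4}`** with Hara's constants
`Cbig` (`LaceExpansionXSpaceChainSplits.lean`, hypotheses `W̄, T̄(0,·)`):
`Σ_x |x|^b |x|^c [diagram](x) ≤ K_b(M) K_c(M) [ |0|^b|0|^c C(0,0) + |0|^b M C(0,c) + |0|^c M C(b,0) + M² C(b,c) ] K^{n-4}`
(`M = 2n+3 = 2N+1`, `K = 2Δ̃_{p_c}Δ_{p_c} ≤ 1`). [cite: Hara2008, §3.4 (Step 3)] -/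
theorem tsum_wE_wE_piNDiagramPc_succ_le_const {b c : ℝ} (hb : 0 ≤ b) (hc : 0 ≤ c) (hKB : KB d ≤ 1) (n : ℕ) :
    ∑' x : Site d, wE b x * wE c x * piNDiagramPc d (n + 1) x ≤
      jK b (2 * n + 3) * jK c (2 * n + 3) *
        (wE b (0 : Site d) * wE c (0 : Site d) * Cbig d 0 0 + wE b (0 : Site d) * ((2 * n + 3 : ℕ) * Cbig d 0 c) +
          wE c (0 : Site d) * ((2 * n + 3 : ℕ) * Cbig d b 0) + (2 * n + 3 : ℕ) * ((2 * n + 3 : ℕ) * Cbig d b c)) *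
        KB d ^ (n - 4) := by
  refine tsum_wE_wE_piNDiagramPc_succ_le_of_chains hb hc n (Cbig d) fun b' c' j l hb' hc' hj hl => ?_
  have hb0 : 0 ≤ b' := by rcases hb' with rfl | rfl; exacts [le_rfl, hb]
  have hc0 : 0 ≤ c' := by rcases hc' with rfl | rfl; exacts [le_rfl, hc]
  exact chain_exv_le hb0 hc0 hKB n hj hl

end Assembly

/-! ### Finiteness of the constants under `W̄^{(β,γ)}, T̄^{(0,γ)}, T̄^{(0,β)} < ∞` -/

section Finite

variable {d : ℕ}

/-- `T̄^{(0,0)} = Δ_{p_c}` (as suprema). [folklore] -/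
theorem haraTBar_zero_zero_eq : haraTBar d 0 0 = percTriBar d := by
  rw [haraTBar_eq_tForm, show gE d 0 = tauPcE d from funext gE_zero_exp, tForm_tau_tau]

/-- A finite list of finite terms has a finite sum. [folklore] -/
theorem sum_map_lt_top {α : Type*} {l : List α} {f : α → ℝ≥0∞} (h : ∀ x ∈ l, f x < ⊤) : (l.map f).sum < ⊤ := by
  induction l with
  | nil => simp
  | cons x l ih =>
    rw [List.map_cons, List.sum_cons]
    exact ENNReal.add_lt_top.2 ⟨h x (by simp), ih fun y hy => h y (by simp [hy])⟩

/-- The basic finite suprema. [folklore] -/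
theorem basic_lt_top {β γ : ℝ} (hβ : 0 ≤ β) (hγ : 0 ≤ γ) (hW : haraWBar d β γ < ⊤)
    (hTγ : haraTBar d 0 γ < ⊤) (hTβ : haraTBar d 0 β < ⊤) :
    haraWBar d β 0 < ⊤ ∧ haraWBar d 0 β < ⊤ ∧ haraWBar d γ 0 < ⊤ ∧ haraWBar d 0 γ < ⊤ ∧ haraWBar d γ β < ⊤ ∧
      haraWBar d 0 0 < ⊤ ∧ haraTBar d 0 0 < ⊤ ∧ haraTBar d γ 0 < ⊤ ∧ haraTBar d β 0 < ⊤ ∧ percTriBar d < ⊤ ∧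
      percTriTildeBar d < ⊤ ∧ KB d < ⊤ := by
  have hWβ0 : haraWBar d β 0 < ⊤ := (haraWBar_le_haraTBar β).trans_lt hTβ
  have hWγ0 : haraWBar d γ 0 < ⊤ := (haraWBar_le_haraTBar γ).trans_lt hTγ
  have hW00 : haraWBar d 0 0 < ⊤ := (haraWBar_zero_zero_le hβ).trans_lt (ENNReal.add_lt_top.2 ⟨hWβ0, ENNReal.one_lt_top⟩)
  have hΔ : percTriBar d < ⊤ := (percTriBar_le hγ).trans_lt (ENNReal.add_lt_top.2 ⟨hTγ, hW00⟩)
  have hΔt : percTriTildeBar d < ⊤ :=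
    percTriTildeBar_le.trans_lt (ENNReal.mul_lt_top (ENNReal.mul_lt_top (by simp) (by simp)) hΔ)
  refine ⟨hWβ0, by rwa [haraWBar_comm], hWγ0, by rwa [haraWBar_comm], by rwa [haraWBar_comm], hW00,
    by rwa [haraTBar_zero_zero_eq], by rwa [haraTBar_comm], by rwa [haraTBar_comm], hΔ, hΔt, ?_⟩
  exact ENNReal.mul_lt_top (ENNReal.mul_lt_top (by simp) hΔt) hΔ

/-- `2^c 2d < ∞`. [folklore] -/
theorem pivC_lt_top (c : ℝ) : pivC d c < ⊤ := ENNReal.mul_lt_top ENNReal.ofReal_lt_top (ENNReal.mul_lt_top (by simp) (by simp))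

/-- `|0|^c < ∞`. [folklore] -/
theorem wE_zero_lt_top (c : ℝ) : wE c (0 : Site d) < ⊤ := ENNReal.ofReal_lt_top

/-- Patterns of sub-markings are patterns. [folklore] -/
theorem mem_pats_of_sub {β γ b c : ℝ} (hb : b = 0 ∨ b = β) (hc : c = 0 ∨ c = γ) {e : ℝ × ℝ} (he : e ∈ pats b c) :
    e ∈ pats β γ := by
  rcases hb with rfl | rfl <;> rcases hc with rfl | rfl <;>
    simp only [pats, List.mem_cons, List.mem_nil_iff, or_false] at he ⊢ <;> tauto

/-- Patterns of sub-markings are patterns (three-pattern version). [folklore] -/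
theorem mem_patsC_of_sub {γ c : ℝ} (hc : c = 0 ∨ c = γ) {e : ℝ × ℝ} (he : e ∈ patsC c) : e ∈ patsC γ := by
  rcases hc with rfl | rfl <;> simp only [patsC, List.mem_cons, List.mem_nil_iff, or_false] at he ⊢ <;> tauto

/-- Finiteness of the `W`/`T` entries for every pattern. [folklore] -/
theorem fin_of_mem_pats {β γ : ℝ} (hβ : 0 ≤ β) (hγ : 0 ≤ γ) (hW : haraWBar d β γ < ⊤)
    (hTγ : haraTBar d 0 γ < ⊤) (hTβ : haraTBar d 0 β < ⊤) {e : ℝ × ℝ} (he : e ∈ pats β γ) :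
    haraWBar d e.1 e.2 < ⊤ ∧ haraWBar d e.1 0 < ⊤ ∧ haraTBar d 0 e.1 < ⊤ := by
  obtain ⟨hWβ0, hW0β, hWγ0, hW0γ, hWγβ, hW00, hT00, -, -, -⟩ := basic_lt_top hβ hγ hW hTγ hTβ
  simp only [pats, List.mem_cons, List.mem_nil_iff, or_false] at he
  rcases he with rfl | rfl | rfl | rfl | rfl | rfl | rfl
  · exact ⟨hW00, hW00, hT00⟩
  · exact ⟨hWβ0, hWβ0, hTβ⟩
  · exact ⟨hW0β, hW00, hT00⟩
  · exact ⟨hWγ0, hWγ0, hTγ⟩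
  · exact ⟨hW0γ, hW00, hT00⟩
  · exact ⟨hW, hWβ0, hTβ⟩
  · exact ⟨hWγβ, hWγ0, hTγ⟩

/-- Finiteness of the `T` entries away from the `b`-mark. [folklore] -/
theorem finC_of_mem_patsC {β γ : ℝ} (hβ : 0 ≤ β) (hγ : 0 ≤ γ) (hW : haraWBar d β γ < ⊤)
    (hTγ : haraTBar d 0 γ < ⊤) (hTβ : haraTBar d 0 β < ⊤) {e : ℝ × ℝ} (he : e ∈ patsC γ) :
    haraTBar d e.1 e.2 < ⊤ ∧ haraTBar d e.1 0 < ⊤ ∧ haraTBar d 0 e.1 < ⊤ := by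
  obtain ⟨-, -, -, -, -, -, hT00, hTγ0, -, -⟩ := basic_lt_top hβ hγ hW hTγ hTβ
  simp only [patsC, List.mem_cons, List.mem_nil_iff, or_false] at he
  rcases he with rfl | rfl | rfl
  · exact ⟨hT00, hT00, hT00⟩
  · exact ⟨hTγ0, hTγ0, hTγ⟩
  · exact ⟨hTγ, hT00, hT00⟩

/-- **The constant is finite** for the marking `(b,c)` with `b ∈ {0,β}`, `c ∈ {0,γ}`.
[cite: Hara2008, §3.4 (Step 3: "with a finite constant c")] -/
theorem Cbig_lt_top {β γ b c : ℝ} (hβ : 0 ≤ β) (hγ : 0 ≤ γ) (hW : haraWBar d β γ < ⊤)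
    (hTγ : haraTBar d 0 γ < ⊤) (hTβ : haraTBar d 0 β < ⊤) (hb : b = 0 ∨ b = β) (hc : c = 0 ∨ c = γ) :
    Cbig d b c < ⊤ := by
  obtain ⟨-, -, -, -, -, -, -, -, -, -, -, hKB⟩ := basic_lt_top hβ hγ hW hTγ hTβ
  have hone : (1 : ℝ≥0∞) < ⊤ := ENNReal.one_lt_top
  have hS : Ssum d c < ⊤ := sum_map_lt_top fun e he =>
    (finC_of_mem_patsC hβ hγ hW hTγ hTβ (mem_patsC_of_sub hc he)).1
  have hRe : ∀ e ∈ patsC c, rungB d e < ⊤ := fun e he => by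
    obtain ⟨h1, h2, -⟩ := finC_of_mem_patsC hβ hγ hW hTγ hTβ (mem_patsC_of_sub hc he)
    exact ENNReal.mul_lt_top (pivC_lt_top _) (ENNReal.add_lt_top.2 ⟨h1, h2⟩)
  have hBe : ∀ e ∈ patsC c, b2B d e < ⊤ := fun e he => by
    obtain ⟨h1, -, h3⟩ := finC_of_mem_patsC hβ hγ hW hTγ hTβ (mem_patsC_of_sub hc he)
    exact ENNReal.add_lt_top.2 ⟨h1, ENNReal.mul_lt_top (wE_zero_lt_top _) h3⟩
  have hR : Rsum d c < ⊤ := sum_map_lt_top hRe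
  have hU : Usum d c < ⊤ := ENNReal.add_lt_top.2 ⟨hKB, sum_map_lt_top fun e₁ h₁ =>
    sum_map_lt_top fun e₂ h₂ => ENNReal.mul_lt_top (hBe e₂ h₂) (hRe e₁ h₁)⟩
  have hM : Msum d b c < ⊤ := sum_map_lt_top fun e he => by
    obtain ⟨h1, h2, -⟩ := fin_of_mem_pats hβ hγ hW hTγ hTβ (mem_pats_of_sub hb hc he)
    exact ENNReal.mul_lt_top (pivC_lt_top _) (ENNReal.add_lt_top.2 ⟨h1, h2⟩)
  have hWs : Wsum d b c < ⊤ := sum_map_lt_top fun e he => (fin_of_mem_pats hβ hγ hW hTγ hTβ (mem_pats_of_sub hb hc he)).1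
  have hT : Tsum d b c < ⊤ := sum_map_lt_top fun e he =>
    ENNReal.mul_lt_top (wE_zero_lt_top _) (fin_of_mem_pats hβ hγ hW hTγ hTβ (mem_pats_of_sub hb hc he)).2.2
  have hS1 := ENNReal.add_lt_top.2 ⟨hone, hS⟩
  have hU1 := ENNReal.add_lt_top.2 ⟨hone, hU⟩
  have hM1 := ENNReal.add_lt_top.2 ⟨hone, hM⟩
  have hR1 := ENNReal.add_lt_top.2 ⟨hone, hR⟩
  have hW1 := ENNReal.add_lt_top.2 ⟨hone, hWs⟩
  have hT1 := ENNReal.add_lt_top.2 ⟨hone, hT⟩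
  unfold Cbig
  refine ENNReal.mul_lt_top (ENNReal.mul_lt_top (ENNReal.pow_lt_top hS1) (ENNReal.pow_lt_top hU1))
    (ENNReal.add_lt_top.2 ⟨ENNReal.add_lt_top.2 ⟨ENNReal.mul_lt_top hM1 hR1,
      ENNReal.mul_lt_top hW1 (ENNReal.pow_lt_top hR1)⟩, ENNReal.mul_lt_top (ENNReal.mul_lt_top hM1 hT1) hR1⟩)

end Finite

/-! ### The weighted `N`-loop bound in Hara's form -/

section RealForm

variable {d : ℕ}

/-- `|x|^b |x|^c = |x|^{b+c}` in `[0, ∞]` (`b, c ≥ 0`). [folklore] -/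
theorem wE_mul_wE {b c : ℝ} (hb : 0 ≤ b) (hc : 0 ≤ c) (x : Site d) :
    wE b x * wE c x = ENNReal.ofReal (euclidNorm x ^ (b + c)) := by
  rw [wE, wE, ← ENNReal.ofReal_mul (Real.rpow_nonneg (euclidNorm_nonneg x) b),
    Real.rpow_add_of_nonneg (euclidNorm_nonneg x) hb hc]

/-- **Hara's form of the weighted `N`-loop estimate from any finite per-chain constants** ("the `N`-loop
contribution is thus bounded by `c N^{2+β+γ} (2c'λ)^{N-2}`"): if every doubly marked chain of the diagram of
`Π^{(n+1)}` (marks `b' ∈ {0,β}`, `c' ∈ {0,γ}`) is `≤ C(b',c') K^{n-4}` with `C(b',c') < ∞`, and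
`K = 2Δ̃_{p_c}Δ_{p_c} < 1`, then there are `c` and `ρ ∈ (0,1)` with
`Σ_x |x|^{β+γ} [diagram of Π^{(N)}](x) ≤ c (N+1)^{2+β+γ} ρ^N` for all `N ≥ 1`.
[cite: Hara2008, §3.4 (Step 3 and Summary)] [cite: HeydenreichVanDerHofstad2017, Prop. 7.4 and §7.5.2] -/
theorem weightedNLoopBound_of_chains {β γ : ℝ} (hβ : 0 ≤ β) (hγ : 0 ≤ γ) (Cc : ℝ → ℝ → ℝ≥0∞)
    (hCf : Cc 0 0 < ⊤ ∧ Cc 0 γ < ⊤ ∧ Cc β 0 < ⊤ ∧ Cc β γ < ⊤)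
    (hchain : ∀ (n : ℕ) (b' c' : ℝ) (j l : ℕ), (b' = 0 ∨ b' = β) → (c' = 0 ∨ c' = γ) → j < 2 * n + 3 →
      l < 2 * n + 3 → ∑' p, pkChainL (vDelta d) (mKsE d n (exv j l b' c')) p * eDiag d p ≤ Cc b' c' * KB d ^ (n - 4))
    (hK : KB d < 1) :
    ∃ c ρ : ℝ, 0 < ρ ∧ ρ < 1 ∧ ∀ N : ℕ, 1 ≤ N →
      ∑' x : Site d, ENNReal.ofReal (euclidNorm x ^ (β + γ)) * piNDiagramPc d N x ≤
        ENNReal.ofReal (c * ((N : ℝ) + 1) ^ (2 + β + γ) * ρ ^ N) := by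
  -- the finite constant
  set Cs : ℝ≥0∞ := Cc 0 0 + Cc 0 γ + Cc β 0 + Cc β γ with hCs
  have hCs_top : Cs < ⊤ := ENNReal.add_lt_top.2 ⟨ENNReal.add_lt_top.2 ⟨ENNReal.add_lt_top.2
    ⟨hCf.1, hCf.2.1⟩, hCf.2.2.1⟩, hCf.2.2.2⟩
  set C : ℝ := Cs.toReal with hC
  have hC0 : 0 ≤ C := ENNReal.toReal_nonneg
  have hCs_eq : Cs = ENNReal.ofReal C := (ENNReal.ofReal_toReal hCs_top.ne).symm
  -- the rate
  set k : ℝ := (KB d).toReal with hk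
  have hk0 : 0 ≤ k := ENNReal.toReal_nonneg
  have hk1 : k < 1 := by
    have := (ENNReal.toReal_lt_toReal (hK.trans ENNReal.one_lt_top).ne ENNReal.one_ne_top).2 hK
    simpa using this
  have hKB_eq : KB d = ENNReal.ofReal k := (ENNReal.ofReal_toReal (hK.trans ENNReal.one_lt_top).ne).symm
  set ρ : ℝ := max k (1 / 2) with hρ
  have hρ0 : 0 < ρ := lt_max_of_lt_right (by norm_num)
  have hρ1 : ρ < 1 := max_lt hk1 (by norm_num)
  have hkρ : k ≤ ρ := le_max_left _ _
  refine ⟨4 * 2 ^ (β + γ) * (ρ⁻¹ ^ 5 * C), ρ, hρ0, hρ1, fun N hN => ?_⟩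
  obtain ⟨n, rfl⟩ : ∃ n, N = n + 1 := ⟨N - 1, by omega⟩
  -- the `[0, ∞]` bound
  have hmain := tsum_wE_wE_piNDiagramPc_succ_le_of_chains (d := d) hβ hγ n Cc (hchain n)
  -- `(1)` the bracket is at most `M² Cs`
  have hM1 : (1 : ℝ≥0∞) ≤ ((2 * n + 3 : ℕ) : ℝ≥0∞) := by exact_mod_cast (show 1 ≤ 2 * n + 3 by omega)
  have hw1 : ∀ t : ℝ, wE t (0 : Site d) ≤ 1 := fun t => wE_zero_le_one t
  have hbr : wE β (0 : Site d) * wE γ (0 : Site d) * Cc 0 0 + wE β (0 : Site d) * ((2 * n + 3 : ℕ) * Cc 0 γ) +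
      wE γ (0 : Site d) * ((2 * n + 3 : ℕ) * Cc β 0) + (2 * n + 3 : ℕ) * ((2 * n + 3 : ℕ) * Cc β γ) ≤
      ((2 * n + 3 : ℕ) : ℝ≥0∞) ^ 2 * Cs := by
    have hsq : ∀ X : ℝ≥0∞, X ≤ ((2 * n + 3 : ℕ) : ℝ≥0∞) ^ 2 * X := fun X =>
      le_mul_of_one_le_left' (one_le_pow_of_one_le' hM1 2)
    have hMsq : ∀ X : ℝ≥0∞, ((2 * n + 3 : ℕ) : ℝ≥0∞) * X ≤ ((2 * n + 3 : ℕ) : ℝ≥0∞) ^ 2 * X := fun X => by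
      rw [pow_two, mul_assoc]; exact le_mul_of_one_le_left' hM1
    rw [hCs, mul_add, mul_add, mul_add]
    refine add_le_add (add_le_add (add_le_add ?_ ?_) ?_) ?_
    · exact (mul_le_of_le_one_left' (mul_le_one' (hw1 β) (hw1 γ))).trans (hsq _)
    · exact (mul_le_of_le_one_left' (hw1 β)).trans (hMsq _)
    · exact (mul_le_of_le_one_left' (hw1 γ)).trans (hMsq _)
    · rw [← mul_assoc, ← pow_two]
  -- `(2)` the polynomial constants
  have hjK : jK β (2 * n + 3) * jK γ (2 * n + 3) ≤ ENNReal.ofReal ((2 * ((n : ℝ) + 1 + 1)) ^ (β + γ)) := by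
    refine (mul_le_mul' (jK_le hβ _) (jK_le hγ _)).trans (le_of_eq ?_)
    rw [← ENNReal.ofReal_mul (by positivity), ← Real.rpow_add (by positivity)]
    congr 2; push_cast; ring
  -- `(3)` the geometric factor
  have hgeo : KB d ^ (n - 4) ≤ ENNReal.ofReal (ρ⁻¹ ^ 5 * ρ ^ (n + 1)) := by
    rw [hKB_eq, ← ENNReal.ofReal_pow hk0]
    refine ENNReal.ofReal_le_ofReal ?_
    calc k ^ (n - 4) ≤ ρ ^ (n - 4) := pow_le_pow_left₀ hk0 hkρ _
      _ = ρ⁻¹ ^ 5 * (ρ ^ 5 * ρ ^ (n - 4)) := by rw [← mul_assoc, ← mul_pow, inv_mul_cancel₀ hρ0.ne', one_pow, one_mul]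
      _ ≤ ρ⁻¹ ^ 5 * ρ ^ (n + 1) := by
          refine mul_le_mul_of_nonneg_left ?_ (by positivity)
          rw [← pow_add]
          exact pow_le_pow_of_le_one hρ0.le hρ1.le (by omega)
  -- combine
  calc ∑' x : Site d, ENNReal.ofReal (euclidNorm x ^ (β + γ)) * piNDiagramPc d (n + 1) x
      = ∑' x : Site d, wE β x * wE γ x * piNDiagramPc d (n + 1) x := tsum_congr fun x => by rw [wE_mul_wE hβ hγ]
    _ ≤ jK β (2 * n + 3) * jK γ (2 * n + 3) * (((2 * n + 3 : ℕ) : ℝ≥0∞) ^ 2 * Cs) * KB d ^ (n - 4) :=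
        hmain.trans (mul_le_mul' (mul_le_mul' le_rfl hbr) le_rfl)
    _ ≤ ENNReal.ofReal ((2 * ((n : ℝ) + 1 + 1)) ^ (β + γ)) *
          (ENNReal.ofReal (((2 * n + 3 : ℕ) : ℝ) ^ 2) * ENNReal.ofReal C) * ENNReal.ofReal (ρ⁻¹ ^ 5 * ρ ^ (n + 1)) := by
        refine mul_le_mul' (mul_le_mul' hjK (le_of_eq ?_)) hgeo
        rw [hCs_eq, ← ENNReal.ofReal_natCast, ENNReal.ofReal_pow (by positivity)]
    _ = ENNReal.ofReal ((2 * ((n : ℝ) + 1 + 1)) ^ (β + γ) * ((((2 * n + 3 : ℕ) : ℝ) ^ 2) * C) * (ρ⁻¹ ^ 5 * ρ ^ (n + 1))) := by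
        rw [← ENNReal.ofReal_mul (by positivity), ← ENNReal.ofReal_mul (by positivity),
          ← ENNReal.ofReal_mul (by positivity)]
    _ ≤ ENNReal.ofReal (4 * 2 ^ (β + γ) * (ρ⁻¹ ^ 5 * C) * (((n + 1 : ℕ) : ℝ) + 1) ^ (2 + β + γ) * ρ ^ (n + 1)) := by
        refine ENNReal.ofReal_le_ofReal ?_
        have hN1 : (0 : ℝ) < ((n + 1 : ℕ) : ℝ) + 1 := by positivity
        have h2 : (2 * ((n : ℝ) + 1 + 1)) ^ (β + γ) = 2 ^ (β + γ) * (((n + 1 : ℕ) : ℝ) + 1) ^ (β + γ) := by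
          rw [Real.mul_rpow (by norm_num) (by positivity)]; push_cast; ring_nf
        have h3 : (((2 * n + 3 : ℕ) : ℝ)) ^ 2 ≤ 4 * (((n + 1 : ℕ) : ℝ) + 1) ^ 2 := by
          have hn : (0 : ℝ) ≤ n := Nat.cast_nonneg n
          push_cast; nlinarith [hn]
        have h4 : (((n + 1 : ℕ) : ℝ) + 1) ^ (2 + β + γ) = (((n + 1 : ℕ) : ℝ) + 1) ^ 2 * (((n + 1 : ℕ) : ℝ) + 1) ^ (β + γ) := by
          rw [show 2 + β + γ = (2 : ℝ) + (β + γ) by ring, Real.rpow_add hN1, Real.rpow_two]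
        rw [h2, h4]
        have hA : 0 ≤ 2 ^ (β + γ) * (((n + 1 : ℕ) : ℝ) + 1) ^ (β + γ) := by positivity
        have hB : 0 ≤ ρ⁻¹ ^ 5 * ρ ^ (n + 1) := by positivity
        calc 2 ^ (β + γ) * (((n + 1 : ℕ) : ℝ) + 1) ^ (β + γ) * ((((2 * n + 3 : ℕ) : ℝ)) ^ 2 * C) * (ρ⁻¹ ^ 5 * ρ ^ (n + 1))
            ≤ 2 ^ (β + γ) * (((n + 1 : ℕ) : ℝ) + 1) ^ (β + γ) * (4 * (((n + 1 : ℕ) : ℝ) + 1) ^ 2 * C) * (ρ⁻¹ ^ 5 * ρ ^ (n + 1)) :=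
              mul_le_mul_of_nonneg_right (mul_le_mul_of_nonneg_left (mul_le_mul_of_nonneg_right h3 hC0) hA) hB
          _ = _ := by ring


/-- **Hara's weighted `N`-loop estimate on the diagrams (7.4.10) at `p_c`, `T̄^{(0,β)}`-variant** ("the
`N`-loop contribution is thus bounded by `c N^{2+β+γ} (2c'λ)^{N-2}`"): for `β, γ ≥ 0` with
`W̄^{(β,γ)}, T̄^{(0,γ)}, T̄^{(0,β)} < ∞` and `K = 2Δ̃_{p_c}Δ_{p_c} < 1` there are `c` and `ρ ∈ (0,1)` with
`Σ_x |x|^{β+γ} [diagram of Π^{(N)}](x) ≤ c (N+1)^{2+β+γ} ρ^N` for all `N ≥ 1`.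
[cite: Hara2008, §3.4 (Steps 1–3)] [cite: HeydenreichVanDerHofstad2017, Prop. 7.4 and §7.5.2] -/
theorem weightedNLoopBound_of_small {β γ : ℝ} (hβ : 0 ≤ β) (hγ : 0 ≤ γ) (hW : haraWBar d β γ < ⊤)
    (hTγ : haraTBar d 0 γ < ⊤) (hTβ : haraTBar d 0 β < ⊤) (hK : KB d < 1) :
    ∃ c ρ : ℝ, 0 < ρ ∧ ρ < 1 ∧ ∀ N : ℕ, 1 ≤ N →
      ∑' x : Site d, ENNReal.ofReal (euclidNorm x ^ (β + γ)) * piNDiagramPc d N x ≤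
        ENNReal.ofReal (c * ((N : ℝ) + 1) ^ (2 + β + γ) * ρ ^ N) := by
  refine weightedNLoopBound_of_chains hβ hγ (Cbig d)
    ⟨Cbig_lt_top hβ hγ hW hTγ hTβ (Or.inl rfl) (Or.inl rfl), Cbig_lt_top hβ hγ hW hTγ hTβ (Or.inl rfl) (Or.inr rfl),
      Cbig_lt_top hβ hγ hW hTγ hTβ (Or.inr rfl) (Or.inl rfl), Cbig_lt_top hβ hγ hW hTγ hTβ (Or.inr rfl) (Or.inr rfl)⟩
    (fun n b' c' j l hb' hc' hj hl => ?_) hK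
  have hb0 : 0 ≤ b' := by rcases hb' with rfl | rfl; exacts [le_rfl, hβ]
  have hc0 : 0 ≤ c' := by rcases hc' with rfl | rfl; exacts [le_rfl, hγ]
  exact chain_exv_le hb0 hc0 hK.le n hj hl

end RealForm

/-- **From a weighted `N`-loop bound to the weighted moment of the coefficient** (the summation over `N` of
Hara's §3.4, "Summing this over `N ≥ 2` and taking care of `N = 0, 1` separately proves the lemma"): for `d ≥ 11`
and the lace-expansion coefficient `Φ`, if `W̄^{(β,γ)} < ∞` (the `N = 0` term) and
`Σ_x |x|^{β+γ}[diagram of Π^{(N)}](x) ≤ c (N+1)^{2+β+γ} ρ^N` for `N ≥ 1` with `ρ < 1`, then — the diagrams being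
summable, so that `HvdH2017_piNDiagramBoundPc` places the Hara–Slade coefficients below them —
`Σ_x |x|^{β+γ} |Φ(x)| < ∞`. The proof is that of `Hara2008_lemma16Pc_of_diagramBounds`
(`LaceExpansionXSpaceLemma16.lean`). [cite: Hara2008, §3.4 (Summary)]
[cite: HeydenreichVanDerHofstad2017, Cor. 8.13] -/
theorem summable_weight_mul_abs_of_weightedBound (h₁ : HvdH2017_piNDiagramBoundPc) {d : ℕ} (hd : 11 ≤ d)
    {Φ : Site d → ℝ} (hΦ : IsLaceCoefficientPc d Φ) {β γ : ℝ} (hβ : 0 ≤ β) (hγ : 0 ≤ γ)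
    (hW : haraWBar d β γ < ⊤) {c ρ : ℝ} (hρ0 : 0 < ρ) (hρ1 : ρ < 1)
    (hB : ∀ N : ℕ, 1 ≤ N →
      ∑' x : Site d, ENNReal.ofReal (euclidNorm x ^ (β + γ)) * piNDiagramPc d N x ≤
        ENNReal.ofReal (c * ((N : ℝ) + 1) ^ (2 + β + γ) * ρ ^ N)) :
    Summable fun x : Site d => euclidNorm x ^ (β + γ) * |Φ x| := by
  have hd1 : 1 ≤ d := by omega
  have hfin : (∑' N : ℕ, ∑' x : Site d, piNDiagramPc d N x) ≠ ⊤ :=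
    tsum_piNDiagramPc_ne_top_of_weightedBound hd1 (add_nonneg hβ hγ) hW hρ0 hρ1 hB
  obtain ⟨P, h0, hsum, hhas, hP0, hPN⟩ := h₁ d hd hfin Φ hΦ
  have hw0 : ∀ x : Site d, 0 ≤ euclidNorm x ^ (β + γ) := fun x =>
    Real.rpow_nonneg (euclidNorm_nonneg x) _
  -- the majorants of the `N`-th weighted sums
  set A : ℕ → ℝ := fun N => (haraWBar d β γ).toReal * (if N = 0 then 1 else 0) +
    |c| * ((N : ℝ) + 1) ^ (2 + (β + γ)) * ρ ^ N with hA
  have hN : ∀ N, (Summable fun x : Site d => euclidNorm x ^ (β + γ) * P N x) ∧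
      ∑' x : Site d, euclidNorm x ^ (β + γ) * P N x ≤ A N := by
    intro N
    rcases Nat.eq_zero_or_pos N with rfl | hNpos
    · -- `N = 0`: bounded by `W̄^{(β,γ)}`
      have hle : ∑' x : Site d, ENNReal.ofReal (euclidNorm x ^ (β + γ) * P 0 x) ≤ haraWBar d β γ :=
        le_trans (ENNReal.tsum_le_tsum fun x => ENNReal.ofReal_le_ofReal
          (mul_le_mul_of_nonneg_left (hP0 x) (hw0 x))) (tsum_weight_mul_piZero_le β γ)
      obtain ⟨hs', ht'⟩ := summable_and_tsum_le_of_tsum_ofReal_le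
        (fun x => mul_nonneg (hw0 x) (h0 0 x)) hW.ne hle
      have hA0 : A 0 = (haraWBar d β γ).toReal + |c| := by simp [hA]
      exact ⟨hs', ht'.trans (hA0 ▸ le_add_of_nonneg_right (abs_nonneg c))⟩
    · -- `N ≥ 1`: Hara's `N`-loop bound
      have hle : ∑' x : Site d, ENNReal.ofReal (euclidNorm x ^ (β + γ) * P N x) ≤
          ENNReal.ofReal (c * ((N : ℝ) + 1) ^ (2 + β + γ) * ρ ^ N) := by
        refine le_trans (ENNReal.tsum_le_tsum fun x => ?_) (hB N hNpos)
        rw [ENNReal.ofReal_mul (hw0 x)]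
        exact mul_le_mul' le_rfl (hPN N hNpos x)
      obtain ⟨hs', ht'⟩ := summable_and_tsum_le_of_tsum_ofReal_le
        (fun x => mul_nonneg (hw0 x) (h0 N x)) ENNReal.ofReal_ne_top hle
      refine ⟨hs', ht'.trans ?_⟩
      have hP : 0 ≤ ((N : ℝ) + 1) ^ (2 + (β + γ)) * ρ ^ N := by positivity
      have hA1 : A N = |c| * ((N : ℝ) + 1) ^ (2 + (β + γ)) * ρ ^ N := by simp [hA, hNpos.ne']
      rw [ENNReal.toReal_ofReal', hA1, show 2 + β + γ = 2 + (β + γ) by ring]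
      refine max_le ?_ (by positivity)
      calc c * ((N : ℝ) + 1) ^ (2 + (β + γ)) * ρ ^ N = c * (((N : ℝ) + 1) ^ (2 + (β + γ)) * ρ ^ N) := by
            ring
        _ ≤ |c| * (((N : ℝ) + 1) ^ (2 + (β + γ)) * ρ ^ N) := mul_le_mul_of_nonneg_right (le_abs_self c) hP
        _ = |c| * ((N : ℝ) + 1) ^ (2 + (β + γ)) * ρ ^ N := by ring
  -- `Σ_N A N < ∞`
  have hAs : Summable A := by
    rw [hA]
    refine Summable.add ?_ ?_
    · refine summable_of_ne_finset_zero (s := {0}) fun N hN => ?_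
      rw [Finset.mem_singleton] at hN
      rw [if_neg hN, mul_zero]
    · refine ((summable_succ_rpow_mul_geometric (2 + (β + γ)) hρ0 hρ1).mul_left |c|).congr
        fun N => ?_
      ring
  -- the non-negative double series `Σ_{N,x} |x|^{β+γ} Π^{(N)}(x)` converges
  have hf : Summable fun Nx : ℕ × Site d => euclidNorm Nx.2 ^ (β + γ) * P Nx.1 Nx.2 := by
    refine (summable_prod_of_nonneg fun Nx => mul_nonneg (hw0 Nx.2) (h0 Nx.1 Nx.2)).2
      ⟨fun N => (hN N).1, ?_⟩
    exact Summable.of_nonneg_of_le (fun N => tsum_nonneg fun x => mul_nonneg (hw0 x) (h0 N x))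
      (fun N => (hN N).2) hAs
  have hFx : Summable fun x : Site d => ∑' N : ℕ, euclidNorm x ^ (β + γ) * P N x :=
    hf.prod_symm.prod
  -- `|x|^{β+γ} |Π(x)| ≤ Σ_N |x|^{β+γ} Π^{(N)}(x)`
  have hpt : ∀ x : Site d, euclidNorm x ^ (β + γ) * |Φ x| ≤
      ∑' N : ℕ, euclidNorm x ^ (β + γ) * P N x := by
    intro x
    have hPx : Summable fun N : ℕ => P N x := hsum.prod_symm.prod_factor x
    have hnorm : Summable fun N : ℕ => ‖(-1 : ℝ) ^ N * P N x‖ := by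
      refine hPx.congr fun N => ?_
      rw [Real.norm_eq_abs, abs_mul, abs_pow, abs_neg, abs_one, one_pow, one_mul,
        abs_of_nonneg (h0 N x)]
    have habs : |Φ x| ≤ ∑' N : ℕ, P N x := by
      rw [← (hhas x).tsum_eq]
      calc |∑' N : ℕ, (-1 : ℝ) ^ N * P N x| = ‖∑' N : ℕ, (-1 : ℝ) ^ N * P N x‖ :=
            (Real.norm_eq_abs _).symm
        _ ≤ ∑' N : ℕ, ‖(-1 : ℝ) ^ N * P N x‖ := norm_tsum_le_tsum_norm hnorm
        _ = ∑' N : ℕ, P N x := tsum_congr fun N => by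
            rw [Real.norm_eq_abs, abs_mul, abs_pow, abs_neg, abs_one, one_pow, one_mul,
              abs_of_nonneg (h0 N x)]
    calc euclidNorm x ^ (β + γ) * |Φ x| ≤ euclidNorm x ^ (β + γ) * ∑' N : ℕ, P N x :=
          mul_le_mul_of_nonneg_left habs (hw0 x)
      _ = ∑' N : ℕ, euclidNorm x ^ (β + γ) * P N x := tsum_mul_left.symm
  exact Summable.of_nonneg_of_le (fun x => mul_nonneg (hw0 x) (abs_nonneg _)) hpt hFx

/-- **Hara 2008, Lemma 1.6 (percolation) in the `T̄^{(0,β)}`-variant, from the Hara–Slade coefficients at `p_c`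
and the smallness `2Δ̃_{p_c}Δ_{p_c} < 1`** (Steps 1–3 of §3.4 PROVED on the diagrams (7.4.10); see the module
docstring for why `T̄^{(0,β)}` replaces `H̄^{(β)}`): for `d ≥ 11`, the lace-expansion coefficient `Φ`, and
`β, γ ≥ 0` with `W̄^{(β,γ)}, T̄^{(0,γ)}, T̄^{(0,β)} < ∞`, `Σ_x |x|^{β+γ} |Φ(x)| < ∞`.
[cite: Hara2008, Lemma 1.6 and §3.4 (Steps 1–3 and Summary)]
[cite: HeydenreichVanDerHofstad2017, (7.4.10), Prop. 7.4 and Cor. 8.13] -/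
theorem Hara2008_lemma16T_of_diagramBounds (h₁ : HvdH2017_piNDiagramBoundPc)
    (hsmall : ∀ d : ℕ, 11 ≤ d → KB d < 1) :
    ∀ (d : ℕ), 11 ≤ d → ∀ Φ : Site d → ℝ, IsLaceCoefficientPc d Φ →
      ∀ β γ : ℝ, 0 ≤ β → 0 ≤ γ → haraWBar d β γ < ⊤ → haraTBar d 0 γ < ⊤ → haraTBar d 0 β < ⊤ →
        Summable fun x : Site d => euclidNorm x ^ (β + γ) * |Φ x| := by
  intro d hd Φ hΦ β γ hβ hγ hW hT hTβ
  obtain ⟨c, ρ, hρ0, hρ1, hB⟩ := weightedNLoopBound_of_small hβ hγ hW hT hTβ (hsmall d hd)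
  exact summable_weight_mul_abs_of_weightedBound h₁ hd hΦ hβ hγ hW hρ0 hρ1 hB


/-- **Hara's weighted `N`-loop estimate, `T̄^{(0,β)}`-variant, for every `d ≥ 11`** from the numerical
triangle bounds (`FitznerVanDerHofstad2017_triangleBoundsPc`: `K = 2Δ̃_{p_c}Δ_{p_c} < 1`): for `β, γ ≥ 0` with
`W̄^{(β,γ)}, T̄^{(0,γ)}, T̄^{(0,β)} < ∞` there are `c` and `ρ ∈ (0,1)` with
`Σ_x |x|^{β+γ} [diagram of Π^{(N)}](x) ≤ c (N+1)^{2+β+γ} ρ^N` for all `N ≥ 1`. This is the conclusion of the named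
fact `Hara2008_weightedNLoopBoundPc` (`LaceExpansionXSpaceLemma16.lean`) under the hypothesis `T̄^{(0,β)} < ∞` in
place of its `W̄^{(β,0)}, H̄^{(β)} < ∞` (see the module docstring: the printed case (b-7) does not cover the
`γ`-mark on the pivotal line at the vertex `v` of `H^{(β)}`).
[cite: Hara2008, §3.4 (Steps 1–3 and Summary: "c N^{2+β+γ}(2c'λ)^{N-2}")]
[cite: FitznerVanDerHofstad2017, §7 (7.1) and proof of Thm. 1.5] -/
theorem weightedNLoopBoundT_of_triangleBounds (hnum : FitznerVanDerHofstad2017_triangleBoundsPc)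
    {d : ℕ} (hd : 11 ≤ d) {β γ : ℝ} (hβ : 0 ≤ β) (hγ : 0 ≤ γ) (hW : haraWBar d β γ < ⊤)
    (hTγ : haraTBar d 0 γ < ⊤) (hTβ : haraTBar d 0 β < ⊤) :
    ∃ c ρ : ℝ, 0 < ρ ∧ ρ < 1 ∧ ∀ N : ℕ, 1 ≤ N →
      ∑' x : Site d, ENNReal.ofReal (euclidNorm x ^ (β + γ)) * piNDiagramPc d N x ≤
        ENNReal.ofReal (c * ((N : ℝ) + 1) ^ (2 + β + γ) * ρ ^ N) :=
  weightedNLoopBound_of_small hβ hγ hW hTγ hTβ (hnum.two_mul_percTriTildeBar_mul_percTriBar_lt_one hd)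

/-- **Lemma 1.6, `T̄^{(0,β)}`-variant, from the two named inputs of the catalogue**: the Hara–Slade
coefficients at `p_c` below the diagrams (`HvdH2017_piNDiagramBoundPc`) and Fitzner–van der Hofstad's
numerical triangle bounds for `d ≥ 11` (`FitznerVanDerHofstad2017_triangleBoundsPc`, giving
`2Δ̃_{p_c}Δ_{p_c} < 1`): for `d ≥ 11`, the lace-expansion coefficient `Φ` and `β, γ ≥ 0` with
`W̄^{(β,γ)}, T̄^{(0,γ)}, T̄^{(0,β)} < ∞`, `Σ_x |x|^{β+γ} |Φ(x)| < ∞`.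
[cite: Hara2008, Lemma 1.6 and §3.4 (Steps 1–3 and Summary)]
[cite: FitznerVanDerHofstad2017, §7 (7.1) and proof of Thm. 1.5]
[cite: HeydenreichVanDerHofstad2017, (7.4.10), Prop. 7.4 and Cor. 8.13] -/
theorem Hara2008_lemma16T_of_triangleBounds (h₁ : HvdH2017_piNDiagramBoundPc)
    (hnum : FitznerVanDerHofstad2017_triangleBoundsPc) :
    ∀ (d : ℕ), 11 ≤ d → ∀ Φ : Site d → ℝ, IsLaceCoefficientPc d Φ →
      ∀ β γ : ℝ, 0 ≤ β → 0 ≤ γ → haraWBar d β γ < ⊤ → haraTBar d 0 γ < ⊤ → haraTBar d 0 β < ⊤ →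
        Summable fun x : Site d => euclidNorm x ^ (β + γ) * |Φ x| :=
  Hara2008_lemma16T_of_diagramBounds h₁ fun _ hd =>
    hnum.two_mul_percTriTildeBar_mul_percTriBar_lt_one hd

end Literature.Barriers.CriticalPhenomena
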